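import Mathlib
import HarnessLib
import Summits.CriticalPhenomena.Ising3DConformalLimit.Theses.GaussianScaleMixture

/-!
# Route GaussianScaleMixture — assembly (item stmt-CriticalPhenomena-8371)

`Assembly := CriticalTwoPointGSM → GSMRigidity → LimitKernelGSM → TwoPointKernelOfLimit →
RotationUpgradeFromTwoPoint → ExistsScaleCovariantLimit → InversionUpgradeNormalised →
IsingEuclidUpgradeR4NonGaussian → Ising3DConformalLimit` (route file
`Summits/CriticalPhenomena/Ising3DConformalLimit/Theses/GaussianScaleMixture.lean`).

The proof is pure logic over the prelude vocabulary
(`Literature/Probability/LatticeModels/ConformalCovariance.lean`, `…/ScalingLimit3D.lean`):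
take `ρ, Δ, S` from (C) `ExistsScaleCovariantLimit` (normalised, non-degenerate, translation
invariant, scale covariant, `Δ > 0`); `LimitKernelGSM` applied to (G) `CriticalTwoPointGSM`
gives the Gaussian-scale-mixture representation of the kernel `K := fun x => S 2 ![0, x]` off
the origin; `TwoPointKernelOfLimit` gives the remaining hypotheses of (R) `GSMRigidity` (the
window `1/2 ≤ Δ ≤ 1`, continuity and positivity off `0`, homogeneity, nine-mirror invariance
and reflection positivity); (R) then gives `K (R x) = K x` for every linear isometry `R`; (N)
`RotationUpgradeFromTwoPoint` upgrades this to `IsRotationInvariant S`, whence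
`IsEuclideanInvariant S := ⟨translations, rotations⟩`; (D) `InversionUpgradeNormalised` gives
`IsInversionCovariant Δ S`, so `IsMoebiusCovariant Δ S := ⟨Euclid, scale, inversion⟩`; (E)
`IsingEuclidUpgradeR4NonGaussian` gives `HasNontrivialU4 S`; these are exactly the clauses of
`Ising3DConformalLimit = Literature.Probability.LatticeModels.CritIsing3DConformalLimit`.
No definitions are introduced and no published fact is used.
-/

namespace Summit.CriticalPhenomena.Ising3DConformalLimit.Theorems

open Literature.Probability.LatticeModels
open Summit.CriticalPhenomena.Ising3DConformalLimit.Theses.GaussianScaleMixture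

/-- **Assembly of route GaussianScaleMixture** (item stmt-CriticalPhenomena-8371, literally the
route decl `Assembly`): the eight items (G) `CriticalTwoPointGSM`, (R) `GSMRigidity`, the glue
`LimitKernelGSM` and `TwoPointKernelOfLimit`, (N) `RotationUpgradeFromTwoPoint`,
(C) `ExistsScaleCovariantLimit`, (D) `InversionUpgradeNormalised` and (E)
`IsingEuclidUpgradeR4NonGaussian` together imply the conjunct `Ising3DConformalLimit`.
Pure logic: the scale-covariant limit of (C) has an `O(3)`-invariant two-point kernel by
(G) + glue + (R), is rotation invariant by (N), inversion covariant by (D) and non-Gaussian by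
(E); Möbius covariance is by definition Euclidean invariance ∧ scale covariance ∧ inversion
covariance (Di Francesco–Mathieu–Sénéchal 1997, §4.3.1). [folklore] -/
theorem gaussianScaleMixture_assembly_proof :
    Summit.CriticalPhenomena.Ising3DConformalLimit.Theses.GaussianScaleMixture.Assembly := by
  unfold Assembly
  intro hG hR hL hT hN hC hD hE
  obtain ⟨ρ, Δ, S, hρ, hΔ, hlim, hnorm, hnd, htr, hsc⟩ := hC
  -- (G) + glue: the two-point kernel of the limit is a Gaussian scale mixture off the origin
  obtain ⟨ν, hν0, hνK⟩ := hL hG ρ Δ S hρ hlim hnd htr hsc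
  -- glue: the remaining hypotheses of `GSMRigidity` for the kernel `x ↦ S 2 ![0, x]`
  obtain ⟨⟨hΔ1, hΔ2⟩, hcont, hpos, hhom, hmirror⟩ := hT ρ Δ S hρ hlim hnd htr hsc
  -- (R): two-point isotropy
  have hiso : ∀ (R : EuclideanSpace ℝ (Fin 3) ≃ₗᵢ[ℝ] EuclideanSpace ℝ (Fin 3))
      (x : EuclideanSpace ℝ (Fin 3)), S 2 ![0, R x] = S 2 ![0, x] :=
    hR Δ (fun x => S 2 ![0, x]) hΔ1 hΔ2 hcont hpos hhom hmirror ⟨ν, hν0, hνK⟩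
  -- (N): rotation invariance of all `n`-point functions, hence Euclidean invariance
  have hrot : IsRotationInvariant S :=
    hN ρ Δ S hρ hlim hnorm hnd htr hsc (fun R x _ => hiso R x)
  have hEuc : IsEuclideanInvariant S := ⟨htr, hrot⟩
  -- (D): inversion covariance, hence Möbius covariance; (E): non-Gaussianity
  have hinv : IsInversionCovariant Δ S := hD ρ Δ S hρ hlim hnorm hnd hEuc hsc
  have hU4 : HasNontrivialU4 S := hE ρ S hρ hlim hnd
  exact ⟨ρ, Δ, S, hρ, hΔ, hlim, hnd, ⟨hEuc, hsc, hinv⟩, hU4⟩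

end Summit.CriticalPhenomena.Ising3DConformalLimit.Theorems
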